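import Summits.QuantumFields.YangMills.Theorems.FlatTubeReductionRecordProfileAnalyticOfST
import Summits.QuantumFields.YangMills.Theorems.FlatTubeReductionDressedOneOrbitRatePot
import HarnessLib

/-!
# ★★★★ `AnalyticRatePotInput L D M` FOR THE SHARED RECORD PROFILE FROM TWO LANE-A-SHAPED BRICKS: the stiff gap (B-ST) and the off-diagonal defect WITH POTENTIAL (B-OD-pot), both
# stated for the UN-normalised profile `recordProfile L` in lane A's normalisation `Λ_A = (btC/fpZ/γ_A)·λ₀` at the rate twin's weight `recordChi L (1/6) (42D+1) M`
# (route `FlatTubeReduction`, crux K1 `NearFlatRatioLaw` stmt-QuantumFields-24720; seat `ym-line-ftr-p1` g17; rate twin «ratepack-v6»; R2b1 RECORD rung — no summit statement is proved here)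

WHY (crux workfile `Lines/ratepack-v6-port-g17.md` §3–§4).  `stub_coreRateOfEM ⟸ Nonempty (RateTube.AnalyticRatePotInput L D M)` for every `L ≥ 2` (`…RecordWindowSixth.
nearFlatRatioLaw_of_analyticRatePotInput` + lane A's shell).  After `…RecordProfileHT` / `…RecordProfileAnalyticOfST` the structural fields, `hN`, `hT` are theorems and `hST` is lane A's
(B-ST) shape transferred; this file adds the transfer of the LAST field: `hODpot` for `Ω = n_β·Ω_c` follows from an off-diagonal bound WITH POTENTIAL for `Ω_c` itself, because
`boFunAd φ (n·Ω_c) = boFun (φ·n) Ω_c` (the normaliser multiplies the slow amplitude; `0 ≤ n ≤ 1`, measurable, gauge invariant), `∫𝟙d²(φn)² ≤ ∫𝟙d²φ²`, fibre-orthogonality transfers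
(`…StiffTransfer`), and the constants compare (`Λ_A ≤ 3σ_βλ₀`, `γ_A ≤ 6γ_β` eventually — the `u = 1` window identities, `od_constants`).  Result: ★★★★ `recordProfile_analyticInput_of_hST_hOD`
— the two lane-A-shaped hypotheses (hST at gap `θ_A`; hOD-pot with rate `b_A`, `b_A² = O(λ_b²)`, and potential constant `κ_A`) give `Nonempty (AnalyticRatePotInput L D M)` with
`θ₀ = θ_A/2`, `b = 3b_A`, `κ_b = 54κ_A`, for every `D ≥ 1`, `M ≥ M₀(L)`.  These two hypotheses are the v6 skeleton's stubs `stub_hST_A`, `stub_hODpot_A`.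
* `od_scalar`, `od_constants` (scalar), ★★★★ `recordProfile_analyticInput_of_hST_hOD`.
HONEST FRAMING: a CONDITIONAL assembly; (B-ST) is lane A's open pen (to be delivered at `(s,K) = (1/6, 42D+1)`), (B-OD)-pot at rate `O(λ_b)` is the crux-sized open analysis ((C1)-rate,
(C2) colour term in `L²`); femto rung R2b1 (RECORD label); not infinite volume, not a gap, not Clay.  No defs, no named facts, no `sorry`.
-/

set_option autoImplicit false

noncomputable section

open MeasureTheory Filter Topology Real
open scoped BigOperators
open Literature.MathematicalPhysics.QuantumFieldTheory
open Literature.MathematicalPhysics.QuantumLattice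

namespace Summit.QuantumFields.YangMills.Theorems.FemtoTransferGap.RateTube

open Summit.QuantumFields.YangMills.Theorems.FemtoTransferGap
open Summit.QuantumFields.YangMills.Theorems.FemtoTransferGap.TwoLattice
open Summit.QuantumFields.YangMills.Theorems.FemtoTransferGap.TwoLattice.ConstTube
open Summit.QuantumFields.YangMills.Theorems.FemtoTransferGap.TwoLattice.Avg
open Summit.QuantumFields.YangMills.Theorems.FemtoTransferGap.TwoLattice.Stiff (LinkSpace)

variable {L : ℕ} [NeZero L]

omit [NeZero L] in
/-- **The scalar step of the (OD) transfer**: `Λ_A ≤ 3S`, `γ_A ≤ 6γ`, `P_ψ ≤ P_φ` ⇒ `Λ_A·√(b²T + κγ_A P_ψ)·R ≤ S·√((3b)²T + 54κγP_φ)·R` (all quantities nonnegative). [folklore] -/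
theorem od_scalar {ΛA S γA γ T Pψ Pφ κA bA R : ℝ} (hΛ0 : 0 ≤ ΛA) (hΛ : ΛA ≤ 3 * S) (hγA0 : 0 ≤ γA) (hγA : γA ≤ 6 * γ) (hT : 0 ≤ T) (hP0 : 0 ≤ Pψ) (hP : Pψ ≤ Pφ)
    (hκ : 0 ≤ κA) (hR : 0 ≤ R) :
    ΛA * Real.sqrt (bA ^ 2 * T + κA * γA * Pψ) * R ≤ S * Real.sqrt ((3 * bA) ^ 2 * T + 54 * κA * γ * Pφ) * R := by
  have hS : 0 ≤ S := by linarith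
  have hγ0 : 0 ≤ γ := by linarith
  have hX0 : 0 ≤ bA ^ 2 * T + κA * γA * Pψ := by positivity
  refine mul_le_mul_of_nonneg_right ?_ hR
  have h9 : Real.sqrt (9 * (bA ^ 2 * T + κA * γA * Pψ)) = 3 * Real.sqrt (bA ^ 2 * T + κA * γA * Pψ) := by
    rw [Real.sqrt_mul (by norm_num), show (9 : ℝ) = 3 ^ 2 by norm_num, Real.sqrt_sq (by norm_num)]
  have hmono : Real.sqrt (9 * (bA ^ 2 * T + κA * γA * Pψ)) ≤ Real.sqrt ((3 * bA) ^ 2 * T + 54 * κA * γ * Pφ) := by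
    refine Real.sqrt_le_sqrt ?_
    have h1 : γA * Pψ ≤ 6 * γ * Pφ := mul_le_mul hγA hP hP0 (by positivity)
    nlinarith [mul_le_mul_of_nonneg_left h1 hκ]
  calc ΛA * Real.sqrt (bA ^ 2 * T + κA * γA * Pψ) ≤ 3 * S * Real.sqrt (bA ^ 2 * T + κA * γA * Pψ) := mul_le_mul_of_nonneg_right hΛ (Real.sqrt_nonneg _)
    _ = S * Real.sqrt (9 * (bA ^ 2 * T + κA * γA * Pψ)) := by rw [h9]; ring
    _ ≤ S * Real.sqrt ((3 * bA) ^ 2 * T + 54 * κA * γ * Pφ) := mul_le_mul_of_nonneg_left hmono hS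

omit [NeZero L] in
/-- **The constants of the (OD) transfer**: with `0 ≤ b ≤ F`, `Z, γ_A > 0`, `λ₀ ≥ 0`, the window identities at `u = 1` (`n₁²m₁ = ½`, `|m₁ − 1| ≤ ε ≤ ½`, `0 < m₁`), the exact mass
`n₁²·mass₁ = γ > 0`, and `|mass₁ − γ_A| ≤ η·γ_A` with `0 ≤ η ≤ ½`: `b/Z/γ_A·λ₀ ≤ 3·((F/2/Z)/γ·λ₀)` and `γ_A ≤ 6γ`. [folklore] -/
theorem od_constants {b F Z γA lam n₁ m₁ mass₁ γ η ε : ℝ} (hb0 : 0 ≤ b) (hbF : b ≤ F) (hZ : 0 < Z) (hγA : 0 < γA) (hlam : 0 ≤ lam)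
    (hnm : n₁ ^ 2 * m₁ = 1 / 2) (hm1 : |m₁ - 1| ≤ ε) (hε : ε ≤ 1 / 2) (hm0 : 0 < m₁) (hγ : n₁ ^ 2 * mass₁ = γ) (hmass : |mass₁ - γA| ≤ η * γA)
    (hη : η ≤ 1 / 2) :
    b / Z / γA * lam ≤ 3 * (F / 2 / Z / γ * lam) ∧ γA ≤ 6 * γ := by
  have hF0 : 0 ≤ F := hb0.trans hbF
  have hn2 : 0 < n₁ ^ 2 := by
    rcases (sq_nonneg n₁).eq_or_lt with h | h
    · rw [← h, zero_mul] at hnm; norm_num at hnm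
    · exact h
  have hmlo : (1 - η) * γA ≤ mass₁ := by have := (abs_le.mp hmass).1; linarith
  have hmhi : mass₁ ≤ (1 + η) * γA := by have := (abs_le.mp hmass).2; linarith
  have hmass0 : 0 < mass₁ := lt_of_lt_of_le (by nlinarith) hmlo
  have hm1lo : 1 / 2 ≤ m₁ := by have := (abs_le.mp hm1).1; linarith
  have hm1hi : m₁ ≤ 3 / 2 := by have := (abs_le.mp hm1).2; linarith
  have hγe : γ = mass₁ / (2 * m₁) := by
    rw [← hγ, eq_div_iff (by positivity)]
    calc n₁ ^ 2 * mass₁ * (2 * m₁) = 2 * (n₁ ^ 2 * m₁) * mass₁ := by ring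
      _ = mass₁ := by rw [hnm]; ring
  constructor
  · -- `b·mass₁ ≤ 3F·m₁·γ_A`
    have hkey : b * mass₁ ≤ 3 * F * m₁ * γA := by
      have h1 : b * mass₁ ≤ F * ((1 + η) * γA) := mul_le_mul hbF hmhi hmass0.le hF0
      nlinarith [mul_nonneg hF0 hγA.le]
    rw [hγe]
    have e1 : b / Z / γA * lam = (b * mass₁) * (lam / (Z * γA * mass₁)) := by field_simp
    have e2 : 3 * (F / 2 / Z / (mass₁ / (2 * m₁)) * lam) = (3 * F * m₁ * γA) * (lam / (Z * γA * mass₁)) := by field_simp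
    rw [e1, e2]
    exact mul_le_mul_of_nonneg_right hkey (by positivity)
  · rw [hγe, mul_div_assoc', le_div_iff₀ (by positivity)]
    nlinarith

set_option maxHeartbeats 3200000 in
-- one long assembly: the package, the explicit (B-T) brick, the two transfers and the 34-field structure.
/-- ★★★★ **`AnalyticRatePotInput L D M` FROM (B-ST) AND (B-OD)-pot IN LANE-A SHAPE.**  `L ≥ 2` (with a non-zero site), `D ≥ 1`, any core radius `R₁`.  There is `M₀ ≥ 2` such that for
every `M ≥ M₀`, every gap `θ_A ∈ (0,1]` with lane A's (B-ST) shape at `(s,K) = (1/6, 42D+1)` for `Ω_c = recordProfile L` (as in `recordProfile_analytic_of_hST`), and every rate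
`b_A ≥ 0` with `b_A² = O(λ_b(L³β)²)` and constant `κ_A ≥ 0` with the (B-OD)-pot shape — eventually, for bounded measurable gauge-invariant `φ` supported in `{orbitDist < D·recordDelta1 L (1/6) β}`
and bounded measurable `v` supported in `{χ_β ≠ 0}`, fibre-orthogonal to `Ω_c` (`fibreInner`), both `|tubeCross β (boFun φ Ω_c) v|` and `|tubeCross β v (boFun φ Ω_c)|` are
`≤ Λ_A·√(b_A²·T(boFun φ Ω_c) + κ_A·γ_A·∫𝟙_{d<Dδ₁}d²φ²)·√T(v)` — the analytic rate input `RateTube.AnalyticRatePotInput L D M` is INHABITED (`θ₀ = θ_A/2`, `b = 3b_A`, `κ_b = 54κ_A`,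
profile `n_β·recordProfile L β`, radius `r_B`). [cite: Luscher1983, §3] -/
theorem recordProfile_analyticInput_of_hST_hOD (hL2 : 2 ≤ L) (hL : Nonempty (NzSite L)) {D : ℝ} (hD : 1 ≤ D) (R₁ : ℝ → ℝ) :
    ∃ M₀ : ℝ, 2 ≤ M₀ ∧ ∀ M : ℝ, M₀ ≤ M → ∀ θA : ℝ, 0 < θA → θA ≤ 1 →
      (∀ᶠ β : ℝ in atTop, ∀ v : GaugeConfig 3 L SU2 → ℝ, Measurable v → (∃ C : ℝ, ∀ U, |v U| ≤ C) → (∀ U, v U ≠ 0 → recordChi L (1 / 6) (42 * D + 1) M β U ≠ 0) →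
        (∀ u, fibreInner L (softWeight (recordChi L (1 / 6) (42 * D + 1) M β)) (recordProfile L β) v u = 0) →
        tubeForm β v ≤ (1 - θA) * (btC L β (recordProfile L β) (btEps β) (R₁ β) / fpZ (btEps β) / recordGamma L (recordProfile L) β * levelValue su2Rep 1 ((L : ℝ) ^ 3 * β) 0) *
          tubeNormSq (softWeight (recordChi L (1 / 6) (42 * D + 1) M β)) v) →
      ∀ (bA : ℝ → ℝ) (κA : ℝ), 0 ≤ κA → (∀ β, 0 ≤ bA β) → (∃ a : ℝ, ∀ᶠ β : ℝ in atTop, bA β ^ 2 ≤ a * bareLambda ((L : ℝ) ^ 3 * β) ^ 2) →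
      (∀ᶠ β : ℝ in atTop, ∀ (φ : GaugeConfig 3 1 SU2 → ℝ) (v : GaugeConfig 3 L SU2 → ℝ), Measurable φ → (∃ C : ℝ, ∀ u, |φ u| ≤ C) →
        (∀ (g : Site 3 1 → SU2) (u : GaugeConfig 3 1 SU2), φ (gaugeTransform g u) = φ u) → (∀ u, φ u ≠ 0 → orbitDist u < D * recordDelta1 L (1 / 6) β) →
        Measurable v → (∃ C : ℝ, ∀ U, |v U| ≤ C) → (∀ U, v U ≠ 0 → recordChi L (1 / 6) (42 * D + 1) M β U ≠ 0) →
        (∀ u, fibreInner L (softWeight (recordChi L (1 / 6) (42 * D + 1) M β)) (recordProfile L β) v u = 0) →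
        |tubeCross β (boFun L φ (recordProfile L β)) v| ≤
            (btC L β (recordProfile L β) (btEps β) (R₁ β) / fpZ (btEps β) / recordGamma L (recordProfile L) β * levelValue su2Rep 1 ((L : ℝ) ^ 3 * β) 0) *
              Real.sqrt (bA β ^ 2 * tubeNormSq (softWeight (recordChi L (1 / 6) (42 * D + 1) M β)) (boFun L φ (recordProfile L β)) +
                κA * recordGamma L (recordProfile L) β * ∫ u, (if orbitDist u < D * recordDelta1 L (1 / 6) β then orbitDist u ^ 2 else 0) * φ u ^ 2 ∂configMeasure SU2 1) *
              Real.sqrt (tubeNormSq (softWeight (recordChi L (1 / 6) (42 * D + 1) M β)) v) ∧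
          |tubeCross β v (boFun L φ (recordProfile L β))| ≤
            (btC L β (recordProfile L β) (btEps β) (R₁ β) / fpZ (btEps β) / recordGamma L (recordProfile L) β * levelValue su2Rep 1 ((L : ℝ) ^ 3 * β) 0) *
              Real.sqrt (bA β ^ 2 * tubeNormSq (softWeight (recordChi L (1 / 6) (42 * D + 1) M β)) (boFun L φ (recordProfile L β)) +
                κA * recordGamma L (recordProfile L) β * ∫ u, (if orbitDist u < D * recordDelta1 L (1 / 6) β then orbitDist u ^ 2 else 0) * φ u ^ 2 ∂configMeasure SU2 1) *
              Real.sqrt (tubeNormSq (softWeight (recordChi L (1 / 6) (42 * D + 1) M β)) v)) →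
      Nonempty (AnalyticRatePotInput L D M) := by
  have hD0 : 0 ≤ D := zero_le_one.trans hD
  obtain ⟨hΩm, hΩ01, hCΩ, hΩinv⟩ := recordProfile_fields L
  have hΩ0 : ∀ β x, 0 ≤ recordProfile L β x := fun β x => (hΩ01 β x).1
  obtain ⟨hR0, hRsmall, hR1⟩ := recordRadius_eventually (L := L)
  obtain ⟨M₀, hM₀, hpk⟩ := profileDressing_package_Rpos hL2 hL hD0
  obtain ⟨M₁, -, hrec⟩ := fibreMass_pointwise_record_R hL hD0 hΩm hCΩ (fun β x hx => norm_le_of_recordProfile_ne_zero L hx) hR0 hRsmall hR1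
  refine ⟨max M₀ M₁, hM₀.trans (le_max_left _ _), fun M hM θA hθA0 hθA1 hSTA bA κA hκA hbA0 hbAsmall hODA => ?_⟩
  obtain ⟨n, m, W, γ, ε, κ, hκ, hP1, hP2, hP3, hP4, hγpos, hN, hWphys, hW0, hWb, hWsq, hεa, hwin, hn_m, hn01, hn_g, hnpos⟩ := hpk M ((le_max_left _ _).trans hM)
  obtain ⟨κN', a, β₀, -, ha, hrecβ⟩ := hrec M ((le_max_right _ _).trans hM)
  -- the dressed (B-T) brick with explicit constant
  have hΩs : ∀ β (v : Edge 3 L → Fin 3 → ℝ), recordProfile L β (linkEmbed L v) ≠ 0 →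
      v ∈ capBalancedSet L ∧ ‖linkEmbed L v‖ ≤ btLog β * powScale (1 / 2) β ∧ ∀ (e : Edge 3 L) (c : Fin 3), |v e c| ≤ btLog β * powScale (1 / 2) β := fun β v hv => by
    obtain ⟨h1, h2, h3⟩ := recordProfile_support L hv
    refine ⟨h1, h3.trans ((min_le_right _ _).trans (le_of_eq (mul_comm _ _))), fun e c => (h2 e c).trans ((min_le_right _ _).trans (le_of_eq (mul_comm _ _)))⟩
  obtain ⟨κT, hκT0, hκTa, hT⟩ := dressed_hT_eventually_R_explicit (L := L) hD (Ω₀ := recordProfile L) hΩm hΩ0 (fun β x => (hΩ01 β x).2) hΩinv hΩs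
    eventually_recordProfile_mass_pos (n := n) (m := m) (W := W) (εW := ε) (κN := κ) (CW := Real.sqrt (1 + κ / 4)) (κW := κ)
    hn_m hn01 hn_g hWphys hW0 hWb hκ hκ hWsq hεa hwin
  -- the objects
  obtain ⟨cR, hcRdef⟩ : ∃ cR : ℝ → ℝ, cR = fun β =>
      fpBOKernel L β (recordProfile L β) (fpWeight L (btEps β)) 1 1 / transferKernel su2Rep ((L : ℝ) ^ 3 * β) (1 : GaugeConfig 3 1 SU2) 1 / 2 / fpZ (btEps β) := ⟨_, rfl⟩
  obtain ⟨Ω, hΩdef⟩ : ∃ Ω : ℝ → GaugeConfig 3 1 SU2 → LinkSpace L → ℝ, Ω = fun β u x => n β u * recordProfile L β x := ⟨_, rfl⟩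
  obtain ⟨σ, hσdef⟩ : ∃ σ : ℝ → ℝ, σ = fun β => (if 0 < cR β then cR β else 1) / γ β := ⟨_, rfl⟩
  have hσγ : ∀ β, 0 < cR β → σ β * γ β = cR β := fun β h => by rw [hσdef]; dsimp only; rw [if_pos h]; exact div_mul_cancel₀ _ (hγpos β).ne'
  have hσpos : ∀ β, 0 < σ β := fun β => by
    rw [hσdef]; dsimp only
    refine div_pos ?_ (hγpos β)
    by_cases h : 0 < cR β
    · rw [if_pos h]; exact h
    · rw [if_neg h]; exact one_pos
  have hr : ∀ β : ℝ, 0 ≤ min (1 / 40) (powScale (1 / 2) β * btLog β) ∧ min (1 / 40) (powScale (1 / 2) β * btLog β) ≤ 1 / 2 := fun β =>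
    ⟨le_min (by norm_num) (mul_nonneg (powScale_pos _ _).le (zero_le_one.trans (one_le_btLog β))), (min_le_left _ _).trans (by norm_num)⟩
  -- ★ the normalisation comparison, eventually
  obtain ⟨a', hεa'⟩ := hεa
  have hδpos : ∀ β, 0 < D * recordDelta1 L (1 / 6) β := fun β => by
    unfold recordDelta1; exact mul_pos (by linarith) (div_pos (mul_pos (by norm_num) (powScale_pos _ _)) (card_site_pos (L := L)))
  have hcmp : ∀ᶠ β : ℝ in atTop, (1 - θA) * (btC L β (recordProfile L β) (btEps β) (R₁ β) / fpZ (btEps β) / recordGamma L (recordProfile L) β * levelValue su2Rep 1 ((L : ℝ) ^ 3 * β) 0) ≤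
      (1 - θA / 2) * (σ β * levelValue su2Rep 1 ((L : ℝ) ^ 3 * β) 0) := by
    filter_upwards [hT, hwin, hN, Filter.eventually_ge_atTop β₀, Filter.eventually_ge_atTop (0 : ℝ),
      eventually_mul_bareLambda_sq_le (L := L) ha (show 0 < θA / 8 by positivity),
      (eventually_mul_bareLambda_sq_le (L := L) (le_max_right a' 0) (show 0 < θA / 8 by positivity)), hεa'] with β hTβ hwinβ hNβ hβ₀ hβ0 hal hal' hεβ
    have hc : 0 < cR β := by rw [hcRdef]; exact hTβ.1
    have h1' : orbitDist (1 : GaugeConfig 3 1 SU2) = 0 := orbitDist_one (L := 1)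
    have h1 : orbitDist (1 : GaugeConfig 3 1 SU2) < D * recordDelta1 L (1 / 6) β := by rw [h1']; exact hδpos β
    obtain ⟨-, hm1, hm0, hnm⟩ := hwinβ 1 h1
    rw [h1'] at hm1
    simp only [ne_eq, OfNat.ofNat_ne_zero, not_false_eq_true, zero_pow, mul_zero, zero_add] at hm1
    have hγe := hNβ 1 h1
    have hsc := fibreMassAd_scale (softWeight (recordChi L (1 / 6) (42 * D + 1) M β)) (n β) (fun _ x => recordProfile L β x) (1 : GaugeConfig 3 1 SU2)
    have hmassAd : fibreMassAd L (softWeight (recordChi L (1 / 6) (42 * D + 1) M β)) (fun _ x => recordProfile L β x) 1 =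
        fibreMass L (softWeight (recordChi L (1 / 6) (42 * D + 1) M β)) (recordProfile L β) 1 := rfl
    rw [hmassAd] at hsc
    have hγ' : n β 1 ^ 2 * fibreMass L (softWeight (recordChi L (1 / 6) (42 * D + 1) M β)) (recordProfile L β) 1 = γ β := by rw [← hsc]; exact hγe
    obtain ⟨hmass, -⟩ := hrecβ β hβ₀ 1 h1.le
    have hγA := recordGamma_recordProfile_pos L hβ0
    have hmass' : fibreMass L (softWeight (recordChi L (1 / 6) (42 * D + 1) M β)) (recordProfile L β) 1 ≤ (1 + a * bareLambda ((L : ℝ) ^ 3 * β) ^ 2) * recordGamma L (recordProfile L) β := by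
      have h2 := (abs_le.mp hmass).2
      rw [h1'] at h2
      simp only [ne_eq, OfNat.ofNat_ne_zero, not_false_eq_true, zero_pow, mul_zero, zero_add] at h2
      linarith
    have hεle : ε β ≤ θA / 8 := hεβ.trans ((mul_le_mul_of_nonneg_right (le_max_left a' 0) (sq_nonneg _)).trans hal')
    have hσe : σ β = cR β / γ β := by rw [hσdef]; dsimp only; rw [if_pos hc]
    rw [hσe, hcRdef]
    dsimp only
    exact port_comparison hθA0 hθA1
      (div_nonneg (fpBOKernel_nonneg β (hΩm β) (hCΩ β) (hΩ0 β) (measurable_coreWeight _ _) (abs_coreWeight_le _ _) (fun g => (coreWeight_mem_Icc _ _ g).1) 1 1) (transferKernel_pos _ _ _ _).le)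
      (btC_le_diag β (hΩm β) (hCΩ β) (hΩ0 β) _ _) (fpZ_pos (btEps_pos_le β).1) hγA
      (levelValue_su2Rep_nonneg 1 (by positivity) 0) hnm hm1 hm0 hγ' (hγpos β) hmass' (mul_nonneg ha (sq_nonneg _)) hal hεle
  -- ★ the constants of the (OD) transfer, eventually
  have hcmpOD : ∀ᶠ β : ℝ in atTop, btC L β (recordProfile L β) (btEps β) (R₁ β) / fpZ (btEps β) / recordGamma L (recordProfile L) β * levelValue su2Rep 1 ((L : ℝ) ^ 3 * β) 0 ≤
      3 * (σ β * levelValue su2Rep 1 ((L : ℝ) ^ 3 * β) 0) ∧ recordGamma L (recordProfile L) β ≤ 6 * γ β := by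
    filter_upwards [hT, hwin, hN, Filter.eventually_ge_atTop β₀, Filter.eventually_ge_atTop (0 : ℝ),
      eventually_mul_bareLambda_sq_le (L := L) ha (show (0 : ℝ) < 1 / 2 by norm_num),
      (eventually_mul_bareLambda_sq_le (L := L) (le_max_right a' 0) (show (0 : ℝ) < 1 / 2 by norm_num)), hεa'] with β hTβ hwinβ hNβ hβ₀ hβ0 hal hal' hεβ
    have hc : 0 < cR β := by rw [hcRdef]; exact hTβ.1
    have h1' : orbitDist (1 : GaugeConfig 3 1 SU2) = 0 := orbitDist_one (L := 1)
    have h1 : orbitDist (1 : GaugeConfig 3 1 SU2) < D * recordDelta1 L (1 / 6) β := by rw [h1']; exact hδpos β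
    obtain ⟨-, hm1, hm0, hnm⟩ := hwinβ 1 h1
    rw [h1'] at hm1
    simp only [ne_eq, OfNat.ofNat_ne_zero, not_false_eq_true, zero_pow, mul_zero, zero_add] at hm1
    have hγe := hNβ 1 h1
    have hsc := fibreMassAd_scale (softWeight (recordChi L (1 / 6) (42 * D + 1) M β)) (n β) (fun _ x => recordProfile L β x) (1 : GaugeConfig 3 1 SU2)
    have hmassAd : fibreMassAd L (softWeight (recordChi L (1 / 6) (42 * D + 1) M β)) (fun _ x => recordProfile L β x) 1 =
        fibreMass L (softWeight (recordChi L (1 / 6) (42 * D + 1) M β)) (recordProfile L β) 1 := rfl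
    rw [hmassAd] at hsc
    have hγ' : n β 1 ^ 2 * fibreMass L (softWeight (recordChi L (1 / 6) (42 * D + 1) M β)) (recordProfile L β) 1 = γ β := by rw [← hsc]; exact hγe
    obtain ⟨hmass, -⟩ := hrecβ β hβ₀ 1 h1.le
    rw [h1'] at hmass
    simp only [ne_eq, OfNat.ofNat_ne_zero, not_false_eq_true, zero_pow, mul_zero, zero_add] at hmass
    have hγA := recordGamma_recordProfile_pos L hβ0
    have hεle : ε β ≤ 1 / 2 := hεβ.trans ((mul_le_mul_of_nonneg_right (le_max_left a' 0) (sq_nonneg _)).trans hal')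
    have hσe : σ β = cR β / γ β := by rw [hσdef]; dsimp only; rw [if_pos hc]
    rw [hσe, hcRdef]
    dsimp only
    exact od_constants
      (div_nonneg (fpBOKernel_nonneg β (hΩm β) (hCΩ β) (hΩ0 β) (measurable_coreWeight _ _) (abs_coreWeight_le _ _) (fun g => (coreWeight_mem_Icc _ _ g).1) 1 1) (transferKernel_pos _ _ _ _).le)
      (btC_le_diag β (hΩm β) (hCΩ β) (hΩ0 β) _ _) (fpZ_pos (btEps_pos_le β).1) hγA (levelValue_su2Rep_nonneg 1 (by positivity) 0) hnm hm1 hεle hm0 hγ' hmass hal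
  -- ★ the assembly
  obtain ⟨hwm, hwb, hw0, -⟩ : (∀ β, Measurable (softWeight (recordChi L (1 / 6) (42 * D + 1) M β))) ∧
      (∀ β U, |softWeight (recordChi L (1 / 6) (42 * D + 1) M β) U| ≤ Real.exp ((Fintype.card (Edge 3 L) : ℝ) / powScale 1 β ^ 2)) ∧
      (∀ β U, 0 ≤ softWeight (recordChi L (1 / 6) (42 * D + 1) M β) U) ∧ True :=
    ⟨fun β => (softWeight_recordChi_props (L := L) (1 / 6) (42 * D + 1) M β).1, fun β => (softWeight_recordChi_props (L := L) (1 / 6) (42 * D + 1) M β).2.1,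
      fun β => (softWeight_recordChi_props (L := L) (1 / 6) (42 * D + 1) M β).2.2.1, trivial⟩
  have hSTR := hST_transfer_eventually (L := L) (χ := recordChi L (1 / 6) (42 * D + 1) M) hwm hwb hw0 hΩm hCΩ (n := n) hnpos hcmp hSTA
  -- ★ the (OD)-pot transfer
  have hODR : ∀ᶠ β : ℝ in atTop, ∀ (φ : GaugeConfig 3 1 SU2 → ℝ) (v : GaugeConfig 3 L SU2 → ℝ), Measurable φ → (∃ C : ℝ, ∀ u, |φ u| ≤ C) →
      (∀ (g : Site 3 1 → SU2) (u : GaugeConfig 3 1 SU2), φ (gaugeTransform g u) = φ u) → (∀ u, φ u ≠ 0 → orbitDist u < D * recordDelta1 L (1 / 6) β) →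
      Measurable v → (∃ C : ℝ, ∀ U, |v U| ≤ C) → (∀ U, v U ≠ 0 → recordChi L (1 / 6) (42 * D + 1) M β U ≠ 0) →
      (∀ u, fibreInnerAd L (softWeight (recordChi L (1 / 6) (42 * D + 1) M β)) (Ω β) v u = 0) →
      |tubeCross β (boFunAd L φ (Ω β)) v| ≤ (σ β * levelValue su2Rep 1 ((L : ℝ) ^ 3 * β) 0) *
          Real.sqrt ((3 * bA β) ^ 2 * tubeNormSq (softWeight (recordChi L (1 / 6) (42 * D + 1) M β)) (boFunAd L φ (Ω β)) +
            54 * κA * γ β * ∫ u, (if orbitDist u < D * recordDelta1 L (1 / 6) β then orbitDist u ^ 2 else 0) * φ u ^ 2 ∂configMeasure SU2 1) *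
          Real.sqrt (tubeNormSq (softWeight (recordChi L (1 / 6) (42 * D + 1) M β)) v) ∧
      |tubeCross β v (boFunAd L φ (Ω β))| ≤ (σ β * levelValue su2Rep 1 ((L : ℝ) ^ 3 * β) 0) *
          Real.sqrt ((3 * bA β) ^ 2 * tubeNormSq (softWeight (recordChi L (1 / 6) (42 * D + 1) M β)) (boFunAd L φ (Ω β)) +
            54 * κA * γ β * ∫ u, (if orbitDist u < D * recordDelta1 L (1 / 6) β then orbitDist u ^ 2 else 0) * φ u ^ 2 ∂configMeasure SU2 1) *
          Real.sqrt (tubeNormSq (softWeight (recordChi L (1 / 6) (42 * D + 1) M β)) v) := by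
    filter_upwards [hODA, hcmpOD, Filter.eventually_ge_atTop (0 : ℝ)] with β hA hC hβ0 φ v hφm hφb hφg hφs hvm hvb hvs horth
    obtain ⟨hΛ, hγ6⟩ := hC
    obtain ⟨Cφ, hCφ⟩ := hφb
    have hCφ0 : 0 ≤ Cφ := (abs_nonneg _).trans (hCφ 1)
    -- the amplitude `ψ = φ·n_β`
    have hψm : Measurable fun u => φ u * n β u := hφm.mul (hn_m β)
    have hψb : ∃ C : ℝ, ∀ u, |φ u * n β u| ≤ C := ⟨Cφ, fun u => by
      rw [abs_mul, abs_of_nonneg (hn01 β u).1]; exact (mul_le_mul (hCφ u) (hn01 β u).2 (hn01 β u).1 hCφ0).trans (le_of_eq (mul_one _))⟩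
    have hψg : ∀ (g : Site 3 1 → SU2) (u : GaugeConfig 3 1 SU2), φ (gaugeTransform g u) * n β (gaugeTransform g u) = φ u * n β u := fun g u => by rw [hφg, hn_g]
    have hψs : ∀ u, φ u * n β u ≠ 0 → orbitDist u < D * recordDelta1 L (1 / 6) β := fun u h => hφs u (left_ne_zero_of_mul h)
    have horth' : ∀ u, fibreInner L (softWeight (recordChi L (1 / 6) (42 * D + 1) M β)) (recordProfile L β) v u = 0 := fun u =>
      fibreInner_eq_zero_of_fibreInnerAd (hwm β) (hwb β) (hw0 β) (hΩm β) (hCΩ β) (hnpos β) v (by rw [hΩdef] at horth; exact horth u)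
    obtain ⟨hA1, hA2⟩ := hA (fun u => φ u * n β u) v hψm hψb hψg hψs hvm hvb hvs horth'
    have hbo : boFunAd L φ (Ω β) = boFun L (fun u => φ u * n β u) (recordProfile L β) := by
      rw [hΩdef]; funext U; simp only [boFunAd, boFun]; ring
    rw [hbo]
    -- the potential of `ψ` is at most that of `φ`
    obtain ⟨hDm, hD0', hDle, -⟩ := windowMoment_props (L := 1) (D * recordDelta1 L (1 / 6) β)
    have hPle : ∫ u, (if orbitDist u < D * recordDelta1 L (1 / 6) β then orbitDist u ^ 2 else 0) * (φ u * n β u) ^ 2 ∂configMeasure SU2 1 ≤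
        ∫ u, (if orbitDist u < D * recordDelta1 L (1 / 6) β then orbitDist u ^ 2 else 0) * φ u ^ 2 ∂configMeasure SU2 1 := by
      refine integral_mono_of_nonneg (ae_of_all _ fun u => mul_nonneg (hD0' u) (sq_nonneg _)) ?_ (ae_of_all _ fun u => ?_)
      · exact integrable_of_measurable_abs_le _ (hDm.mul (hφm.pow_const 2)) (C := (D * recordDelta1 L (1 / 6) β) ^ 2 * Cφ ^ 2) fun u => by
          rw [abs_mul, abs_of_nonneg (hD0' u), abs_of_nonneg (sq_nonneg _)]
          exact mul_le_mul (hDle u) (by rw [← sq_abs]; exact pow_le_pow_left₀ (abs_nonneg _) (hCφ u) 2) (sq_nonneg _) (sq_nonneg _)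
      · have hn1 : n β u ^ 2 ≤ 1 := by have := (hn01 β u).1; have := (hn01 β u).2; nlinarith
        have e : (φ u * n β u) ^ 2 = φ u ^ 2 * n β u ^ 2 := by ring
        dsimp only
        rw [e]
        exact mul_le_mul_of_nonneg_left (by nlinarith [sq_nonneg (φ u)]) (hD0' u)
    have hP0 : 0 ≤ ∫ u, (if orbitDist u < D * recordDelta1 L (1 / 6) β then orbitDist u ^ 2 else 0) * (φ u * n β u) ^ 2 ∂configMeasure SU2 1 :=
      integral_nonneg fun u => mul_nonneg (hD0' u) (sq_nonneg _)
    have hT0 := tubeNormSq_nonneg' (hw0 β) (boFun L (fun u => φ u * n β u) (recordProfile L β))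
    have hΛ0 : 0 ≤ btC L β (recordProfile L β) (btEps β) (R₁ β) / fpZ (btEps β) / recordGamma L (recordProfile L) β * levelValue su2Rep 1 ((L : ℝ) ^ 3 * β) 0 :=
      mul_nonneg (div_nonneg (div_nonneg (div_nonneg (fpBOKernel_nonneg β (hΩm β) (hCΩ β) (hΩ0 β) (measurable_coreWeight _ _) (abs_coreWeight_le _ _)
        (fun g => (coreWeight_mem_Icc _ _ g).1) 1 1) (transferKernel_pos _ _ _ _).le) (fpZ_pos (btEps_pos_le β).1).le) (recordGamma_recordProfile_pos L hβ0).le)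
        (levelValue_su2Rep_nonneg 1 (by positivity) 0)
    exact ⟨hA1.trans (od_scalar hΛ0 hΛ (recordGamma_recordProfile_pos L hβ0).le hγ6 hT0 hP0 hPle hκA (Real.sqrt_nonneg _)),
      hA2.trans (od_scalar hΛ0 hΛ (recordGamma_recordProfile_pos L hβ0).le hγ6 hT0 hP0 hPle hκA (Real.sqrt_nonneg _))⟩
  -- ★ the three eventual fields in the structure's words
  have hNf : ∀ᶠ β in atTop, ∀ u : GaugeConfig 3 1 SU2, orbitDist u < D * recordDelta1 L (1 / 6) β →
      |fibreMassAd L (softWeight (recordChi L (1 / 6) (42 * D + 1) M β)) (Ω β) u - γ β| ≤ κT β * γ β := by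
    filter_upwards [hN] with β h u hu
    rw [hΩdef, h u hu, sub_self, abs_zero]
    exact mul_nonneg (hκT0 β) (hγpos β).le
  have hTf : ∀ᶠ β in atTop, ∀ φ : GaugeConfig 3 1 SU2 → ℝ, Measurable φ → (∃ C : ℝ, ∀ u, |φ u| ≤ C) →
      (∀ (g : Site 3 1 → SU2) (u : GaugeConfig 3 1 SU2), φ (gaugeTransform g u) = φ u) → (∀ u, φ u ≠ 0 → orbitDist u < D * recordDelta1 L (1 / 6) β) →
      |tubeForm β (boFunAd L φ (Ω β)) - σ β * γ β * qform su2Rep ((L : ℝ) ^ 3 * β) (fun u => φ u * W β u) (fun u => φ u * W β u)| ≤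
        κT β * (σ β * γ β) * (qform su2Rep ((L : ℝ) ^ 3 * β) (fun u => φ u * W β u) (fun u => φ u * W β u) + levelValue su2Rep 1 ((L : ℝ) ^ 3 * β) 0 * l2 φ φ) := by
    filter_upwards [hT] with β h φ hφm hφb hφg hφs
    have hc : 0 < cR β := by rw [hcRdef]; exact h.1
    rw [hσγ β hc, hΩdef, hcRdef]
    exact h.2 φ hφm hφb hφg hφs
  have hSTf : ∀ᶠ β : ℝ in atTop, ∀ v : GaugeConfig 3 L SU2 → ℝ, Measurable v → (∃ C : ℝ, ∀ U, |v U| ≤ C) → (∀ U, v U ≠ 0 → recordChi L (1 / 6) (42 * D + 1) M β U ≠ 0) →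
      (∀ u, fibreInnerAd L (softWeight (recordChi L (1 / 6) (42 * D + 1) M β)) (Ω β) v u = 0) →
      tubeForm β v ≤ (1 - θA / 2) * (σ β * levelValue su2Rep 1 ((L : ℝ) ^ 3 * β) 0) * tubeNormSq (softWeight (recordChi L (1 / 6) (42 * D + 1) M β)) v := by
    filter_upwards [hSTR] with β h v hvm hvb hvs horth
    exact h v hvm hvb hvs (fun u => by rw [hΩdef] at horth; exact horth u)
  -- ★ the structure
  obtain ⟨a₁, ha₁⟩ := hbAsmall
  exact ⟨
    { Ω := Ω, W := W, r := (fun β => min (1 / 40) (powScale (1 / 2) β * btLog β)), σ := σ, γ := γ, κ := κT, b := (fun β => 3 * bA β), θ₀ := θA / 2, κW := κ,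
      κb := 54 * κA,
      CW := Real.sqrt (1 + κ / 4),
      hΩm := (fun β => by rw [hΩdef]; exact hP1 β), hΩ1 := (fun β u x => by rw [hΩdef]; exact hP2 β u x),
      hΩinv := (fun β g u v => by rw [hΩdef]; exact hP3 β g u v),
      hΩr := (fun β u x h => hP4 β u x (by rw [hΩdef] at h; exact h)), hWphys := hWphys, hW0 := hW0, hWbU := hWb, hκW := hκ, hκb := (by positivity), hWsq := hWsq,
      hr := hr, hr_small := hRsmall, hγ := hγpos, hσ := hσpos, hκ0 := hκT0, hκ_small := hκTa, hb := (fun β => by have := hbA0 β; positivity),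
      hb_small := ⟨9 * a₁, (by filter_upwards [ha₁] with β h; nlinarith)⟩, hθ₀ := ⟨(by positivity), (by linarith)⟩,
      hN := hNf, hT := hTf, hST := hSTf, hODpot := hODR }⟩

end Summit.QuantumFields.YangMills.Theorems.FemtoTransferGap.RateTube

end

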